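import Summits.BirchSwinnertonDyer.BirchSwinnertonDyer.Theorems.KolyvaginRoadThreePTDescentAssembly
import HarnessLib

/-!
# Milne *ADT* I Thm. 4.10(b) `Ker γ¹ ⊆ Im β¹` DESCENDS along a finite extension `K'/K` of degree prime to `p` —
# the certificate WITH REAL PLACES (archimedean corestriction data stated as hypotheses; `p = 2` allowed)

Route `ThetaPartnerAtTwo`, crux K4 `SignedControlAtTwo` (stmt-BirchSwinnertonDyer-20309), line `eulerchar` v10, lead
`bsd-wall-tp2-p3` g4 (`--supports stmt-BirchSwinnertonDyer-20309`, helper).  File 7 of the real-place packet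
(`…MuRealKummer` … `…MuRealTwoTorsionPoint`); item (N1) of `Cruxes/SignedControlAtTwo/PT-AT-2-REALPLACES.md`.

bsd-stepL koly's descent certificate `middleExact_canonical_of_descentData` (p555478; Cassels–Fröhlich IV §6 «Res–Cor»)
carries the hypothesis `hKinf : H¹(K_v, M) = 0` at every infinite place `v` of `K` — automatic for odd `p` or `K`
totally complex, FALSE at `p = 2` over `ℚ` (K4's regime: `H¹(ℝ, E[2]) ≠ 0`).  This file is the same certificate with
the infinite places LIVE: besides the finite-place corestriction data (`Cor`, `Res`, `Cor^D` over `w ∣ v` finite, with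
(semi-local), (degree), (adjoint), (unramified), (places)) it takes, for every infinite place `v` of `K` and every
infinite place `w` of `K'` above it (`w.comap (algebraMap K K') = v`), ARCHIMEDEAN data
  `ResI v w : H¹(K_v, M) → H¹(K'_w, M')`, `CorI v w : H¹(K'_w, M') → H¹(K_v, M)`, `CorDI v w` on the duals,
with (semi-local∞) `loc_v ∘ Cor = Σ_{w∣v} CorI ∘ loc_w` for `M` and the duals, (degree∞) `Σ_{w∣v} CorI (ResI a) = d • a`
(true in nature: the real `w ∣ v` number `r ≡ d (mod 2)` and `2·H¹(K_v, M) = 0`; complex `w` contribute `0`), and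
(adjoint∞) for THE archimedean invariant maps of `K` and `K'`; and it asks `S ⊇ {v ∣ ∞}`.  Then Milne I 4.10(b) for
`M'` over `K'` at every admissible `S'` implies it for `M` over `K` at `S`
(`middleExact_canonical_of_descentData_real`).  The argument is koly's, place by place, with `t'_w := ResI t_v`
also at the infinite `w` and `S' := ⋃_{s ∈ S} {places of K' above s}`.

WHY: with file 5 (`middleExact_canonical_of_card_eq_four_of_pow` over the 2-Sylow field) this certificate reduces
Milne I 4.10(b) for `E[2]` over `ℚ` for EVERY elliptic curve (K4's habitat: `ℚ(E[2])/ℚ` of degree 3 or 6, descent along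
the cubic field) to the NATIVE archimedean bricks (the three data with their four compatibilities) — the infinite-place
twin of koly's `…PTDescentLocalData/SemiLocal/Adjoint`, not in the tree.

HONEST FRAMING. THEOREMS ONLY; every archimedean input is a named binder; no case of Poitou–Tate or BSD is proved here.

References: [MilneADT2006] I Thm. 4.10(b); [SerreGaloisCohomology1997] I §2.4; [CasselsFrohlichANT1967] IV §6, VII;
[NeukirchSchmidtWingberg2008] (1.5.6)–(1.5.7), (8.3.20).
-/

noncomputable section

open CategoryTheory Function NumberField IsDedekindDomain
open scoped NumberField ContRepresentation Classical

set_option linter.dupNamespace false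
set_option autoImplicit false

namespace Summit.BirchSwinnertonDyer.BirchSwinnertonDyer.Theorems.SignedEC.MuReal

open Field
open Literature.NumberTheory.GaloisRepresentations Literature.NumberTheory.GaloisCohomology
open Literature.NumberTheory.GaloisRepresentations.DiscreteGaloisModule (mu MuCarrier TateDual tateDual
  localTatePairingZMod unramifiedSubgroup SelmerStructure)
open Literature.NumberTheory.GaloisRepresentations.SemiLocal (Place)
open _root_.TopRep _root_.ContRepresentation _root_.ContinuousCohomology
open Summit.BirchSwinnertonDyer.BirchSwinnertonDyer.Theorems.KolyvaginRoadThreePT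

variable {K K' : Type} [Field K] [NumberField K] [Field K'] [NumberField K'] [Algebra K K']
variable {p : ℕ} [hp : Fact p.Prime]
variable {M : Type} [AddCommGroup M] [TopologicalSpace M] [DiscreteTopology M] [Finite M]
variable {M' : Type} [AddCommGroup M'] [TopologicalSpace M'] [DiscreteTopology M'] [Finite M']

/-- **Milne I Thm. 4.10(b) descends along `K'/K` of degree prime to `p`, given the corestriction package at the
finite AND at the infinite places** (koly's `middleExact_canonical_of_descentData` with `hKinf` replaced by archimedean
`ResI`/`CorI`/`CorDI` and their (semi-local), (degree), (adjoint) compatibilities; `S ⊇ {v ∣ ∞}`).  See the module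
docstring. [cite: MilneADT2006, Ch. I, Thm. 4.10(b)] [cite: SerreGaloisCohomology1997, I §2.4] -/
theorem middleExact_canonical_of_descentData_real
    (ρ : DiscreteGaloisModule K M) (ρ' : DiscreteGaloisModule K' M')
    (hpM : ∀ m : M, p • m = 0) {d : ℕ} (hd : p.Coprime d)
    -- the corestriction data, finite places
    (CorG : galoisCohomology ρ' 1 →+ galoisCohomology ρ 1)
    (CorGD : galoisCohomology (ρ'.tateDual p) 1 →+ galoisCohomology (ρ.tateDual p) 1)
    (Cor : ∀ (v : HeightOneSpectrum (𝓞 K)) (w : Place K K' v),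
      galoisCohomology (ρ'.toLocal (Sum.inr (w : HeightOneSpectrum (𝓞 K')))) 1 →+
        galoisCohomology (ρ.toLocal (Sum.inr v)) 1)
    (Res : ∀ (v : HeightOneSpectrum (𝓞 K)) (w : Place K K' v),
      galoisCohomology (ρ.toLocal (Sum.inr v)) 1 →+
        galoisCohomology (ρ'.toLocal (Sum.inr (w : HeightOneSpectrum (𝓞 K')))) 1)
    (CorD : ∀ (v : HeightOneSpectrum (𝓞 K)) (w : Place K K' v),
      galoisCohomology ((ρ'.tateDual p).toLocal (Sum.inr (w : HeightOneSpectrum (𝓞 K')))) 1 →+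
        galoisCohomology ((ρ.tateDual p).toLocal (Sum.inr v)) 1)
    -- the corestriction data, infinite places
    (ResI : ∀ (v : InfinitePlace K) (w : {w' : InfinitePlace K' // w'.comap (algebraMap K K') = v}),
      galoisCohomology (ρ.toLocal (Sum.inl v)) 1 →+ galoisCohomology (ρ'.toLocal (Sum.inl w.1)) 1)
    (CorI : ∀ (v : InfinitePlace K) (w : {w' : InfinitePlace K' // w'.comap (algebraMap K K') = v}),
      galoisCohomology (ρ'.toLocal (Sum.inl w.1)) 1 →+ galoisCohomology (ρ.toLocal (Sum.inl v)) 1)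
    (CorDI : ∀ (v : InfinitePlace K) (w : {w' : InfinitePlace K' // w'.comap (algebraMap K K') = v}),
      galoisCohomology ((ρ'.tateDual p).toLocal (Sum.inl w.1)) 1 →+
        galoisCohomology ((ρ.tateDual p).toLocal (Sum.inl v)) 1)
    -- (semi-local) for `M` and for the duals, finite and infinite places
    (hsemi : ∀ (v : HeightOneSpectrum (𝓞 K)) (y' : galoisCohomology ρ' 1),
      galoisCohomology.localization ρ (Sum.inr v) 1 (CorG y') =
        ∑ w : Place K K' v, Cor v w
          (galoisCohomology.localization ρ' (Sum.inr (w : HeightOneSpectrum (𝓞 K'))) 1 y'))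
    (hsemiD : ∀ (v : HeightOneSpectrum (𝓞 K)) (y' : galoisCohomology (ρ'.tateDual p) 1),
      galoisCohomology.localization (ρ.tateDual p) (Sum.inr v) 1 (CorGD y') =
        ∑ w : Place K K' v, CorD v w
          (galoisCohomology.localization (ρ'.tateDual p) (Sum.inr (w : HeightOneSpectrum (𝓞 K'))) 1 y'))
    (hsemiI : ∀ (v : InfinitePlace K) (y' : galoisCohomology ρ' 1),
      galoisCohomology.localization ρ (Sum.inl v) 1 (CorG y') =
        ∑ w : {w' : InfinitePlace K' // w'.comap (algebraMap K K') = v}, CorI v w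
          (galoisCohomology.localization ρ' (Sum.inl w.1) 1 y'))
    (hsemiDI : ∀ (v : InfinitePlace K) (y' : galoisCohomology (ρ'.tateDual p) 1),
      galoisCohomology.localization (ρ.tateDual p) (Sum.inl v) 1 (CorGD y') =
        ∑ w : {w' : InfinitePlace K' // w'.comap (algebraMap K K') = v}, CorDI v w
          (galoisCohomology.localization (ρ'.tateDual p) (Sum.inl w.1) 1 y'))
    -- (degree)
    (hdeg : ∀ (v : HeightOneSpectrum (𝓞 K)) (a : galoisCohomology (ρ.toLocal (Sum.inr v)) 1),
      ∑ w : Place K K' v, Cor v w (Res v w a) = d • a)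
    (hdegI : ∀ (v : InfinitePlace K) (a : galoisCohomology (ρ.toLocal (Sum.inl v)) 1),
      ∑ w : {w' : InfinitePlace K' // w'.comap (algebraMap K K') = v}, CorI v w (ResI v w a) = d • a)
    -- (adjoint)
    (hadj : ∀ (v : HeightOneSpectrum (𝓞 K)) (w : Place K K' v)
      (a : galoisCohomology (ρ.toLocal (Sum.inr v)) 1)
      (b' : galoisCohomology ((ρ'.tateDual p).toLocal (Sum.inr (w : HeightOneSpectrum (𝓞 K')))) 1),
      localTatePairingZMod ρ' p (Sum.inr (w : HeightOneSpectrum (𝓞 K')))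
          (LocalInvariants.canonical K' p (Sum.inr (w : HeightOneSpectrum (𝓞 K')))) (Res v w a) b' =
        localTatePairingZMod ρ p (Sum.inr v) (LocalInvariants.canonical K p (Sum.inr v)) a (CorD v w b'))
    (hadjI : ∀ (v : InfinitePlace K) (w : {w' : InfinitePlace K' // w'.comap (algebraMap K K') = v})
      (a : galoisCohomology (ρ.toLocal (Sum.inl v)) 1)
      (b' : galoisCohomology ((ρ'.tateDual p).toLocal (Sum.inl w.1)) 1),
      localTatePairingZMod ρ' p (Sum.inl w.1) (LocalInvariants.canonical K' p (Sum.inl w.1)) (ResI v w a) b' =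
        localTatePairingZMod ρ p (Sum.inl v) (LocalInvariants.canonical K p (Sum.inl v)) a (CorDI v w b'))
    -- (unramified)
    (hur : ∀ (v : HeightOneSpectrum (𝓞 K)) (w : Place K K' v)
      (z' : galoisCohomology (ρ'.toLocal (Sum.inr (w : HeightOneSpectrum (𝓞 K')))) 1),
      z' ∈ unramifiedSubgroup (GaloisRep.toLocal (w : HeightOneSpectrum (𝓞 K')) ρ') 1 →
        Cor v w z' ∈ unramifiedSubgroup (GaloisRep.toLocal v ρ) 1)
    (hurD : ∀ (v : HeightOneSpectrum (𝓞 K)) (w : Place K K' v)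
      (z' : galoisCohomology ((ρ'.tateDual p).toLocal (Sum.inr (w : HeightOneSpectrum (𝓞 K')))) 1),
      z' ∈ unramifiedSubgroup (GaloisRep.toLocal (w : HeightOneSpectrum (𝓞 K')) (ρ'.tateDual p)) 1 →
        CorD v w z' ∈ unramifiedSubgroup (GaloisRep.toLocal v (ρ.tateDual p)) 1)
    -- (places)
    (hram : ∀ (v : HeightOneSpectrum (𝓞 K)) (w : Place K K' v), GaloisRep.IsUnramifiedAt v ρ →
      GaloisRep.IsUnramifiedAt (w : HeightOneSpectrum (𝓞 K')) ρ')
    -- Milne I 4.10(b) over `K'`, all admissible `S'`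
    (hE' : ∀ (S' : Finset (Place K')), (∀ w : InfinitePlace K', (Sum.inl w : Place K') ∈ S') →
      (∀ w : HeightOneSpectrum (𝓞 K'), (Sum.inr w : Place K') ∉ S' →
        ((p : ℕ) : 𝓞 K') ∉ w.asIdeal ∧ GaloisRep.IsUnramifiedAt w ρ') →
      ∀ t' : Π w : Place K', galoisCohomology (ρ'.toLocal w) 1,
      (∀ y' : galoisCohomology (ρ'.tateDual p) 1,
        (∀ w : HeightOneSpectrum (𝓞 K'), (Sum.inr w : Place K') ∉ S' →
          galoisCohomology.localization (ρ'.tateDual p) (Sum.inr w) 1 y' ∈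
            unramifiedSubgroup (GaloisRep.toLocal w (ρ'.tateDual p)) 1) →
        ∑ w ∈ S', localTatePairingZMod ρ' p w (LocalInvariants.canonical K' p w) (t' w)
          (galoisCohomology.localization (ρ'.tateDual p) w 1 y') = 0) →
      ∃ x' : galoisCohomology ρ' 1,
        (∀ w : HeightOneSpectrum (𝓞 K'), (Sum.inr w : Place K') ∉ S' →
          galoisCohomology.localization ρ' (Sum.inr w) 1 x' ∈
            unramifiedSubgroup (GaloisRep.toLocal w ρ') 1) ∧
        ∀ w ∈ S', galoisCohomology.localization ρ' w 1 x' = t' w)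
    -- the admissible `S ⊇ {v ∣ ∞}` over `K` and the datum
    {S : Finset (Place K)} (hinfS : ∀ v : InfinitePlace K, (Sum.inl v : Place K) ∈ S)
    (hS : ∀ v : HeightOneSpectrum (𝓞 K), (Sum.inr v : Place K) ∉ S →
      ((p : ℕ) : 𝓞 K) ∉ v.asIdeal ∧ GaloisRep.IsUnramifiedAt v ρ)
    (t : Π v : Place K, galoisCohomology (ρ.toLocal v) 1)
    (horth : ∀ y : galoisCohomology (ρ.tateDual p) 1,
      (∀ v : HeightOneSpectrum (𝓞 K), (Sum.inr v : Place K) ∉ S →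
        galoisCohomology.localization (ρ.tateDual p) (Sum.inr v) 1 y ∈
          unramifiedSubgroup (GaloisRep.toLocal v (ρ.tateDual p)) 1) →
      ∑ v ∈ S, localTatePairingZMod ρ p v (LocalInvariants.canonical K p v) (t v)
        (galoisCohomology.localization (ρ.tateDual p) v 1 y) = 0) :
    ∃ x : galoisCohomology ρ 1,
      (∀ v : HeightOneSpectrum (𝓞 K), (Sum.inr v : Place K) ∉ S →
        galoisCohomology.localization ρ (Sum.inr v) 1 x ∈ unramifiedSubgroup (GaloisRep.toLocal v ρ) 1) ∧
      ∀ v ∈ S, galoisCohomology.localization ρ v 1 x = t v := by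
  classical
  -- the admissible set `S' = {places of K' above S}` over `K'`
  let above : Place K → Finset (Place K') := fun s =>
    match s with
    | Sum.inl v => (Finset.univ : Finset {w' : InfinitePlace K' // w'.comap (algebraMap K K') = v}).image
        fun w => (Sum.inl w.1 : Place K')
    | Sum.inr v => (Finset.univ : Finset (Place K K' v)).image
        fun w : Place K K' v => (Sum.inr (w : HeightOneSpectrum (𝓞 K')) : Place K')
  have habove_inl : ∀ v : InfinitePlace K, above (Sum.inl v) =
      (Finset.univ : Finset {w' : InfinitePlace K' // w'.comap (algebraMap K K') = v}).image
        fun w => (Sum.inl w.1 : Place K') := fun _ => rfl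
  have habove_inr : ∀ v : HeightOneSpectrum (𝓞 K), above (Sum.inr v) =
      (Finset.univ : Finset (Place K K' v)).image
        fun w : Place K K' v => (Sum.inr (w : HeightOneSpectrum (𝓞 K')) : Place K') := fun _ => rfl
  have hmem_above_inl : ∀ (s : Place K) (w' : InfinitePlace K'), (Sum.inl w' : Place K') ∈ above s ↔
      s = Sum.inl (w'.comap (algebraMap K K')) := by
    rintro (v | v) w'
    · rw [habove_inl, Finset.mem_image]
      constructor
      · rintro ⟨w, -, hw⟩
        rw [← w.2, Sum.inl_injective hw]
      · intro h
        exact ⟨⟨w', (Sum.inl_injective h).symm⟩, Finset.mem_univ _, rfl⟩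
    · rw [habove_inr, Finset.mem_image]
      constructor
      · rintro ⟨w, -, hw⟩; exact absurd hw (by simp)
      · intro h; exact absurd h (by simp)
  have hmem_above_inr : ∀ (s : Place K) (w' : HeightOneSpectrum (𝓞 K')), (Sum.inr w' : Place K') ∈ above s ↔
      s = Sum.inr (w'.under (𝓞 K)) := by
    rintro (v | v) w'
    · rw [habove_inl, Finset.mem_image]
      constructor
      · rintro ⟨w, -, hw⟩; exact absurd hw (by simp)
      · intro h; exact absurd h (by simp)
    · rw [habove_inr, Finset.mem_image]
      constructor
      · rintro ⟨w, -, hw⟩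
        rw [← Sum.inr_injective hw, w.under_eq]
      · intro h
        exact ⟨⟨w', (Sum.inr_injective h).symm⟩, Finset.mem_univ _, rfl⟩
  set S' : Finset (Place K') := S.biUnion above with hS'_def
  have hS'inf : ∀ w : InfinitePlace K', (Sum.inl w : Place K') ∈ S' := fun w => by
    rw [hS'_def, Finset.mem_biUnion]
    exact ⟨Sum.inl (w.comap (algebraMap K K')), hinfS _, (hmem_above_inl _ w).mpr rfl⟩
  have hS'mem : ∀ w : HeightOneSpectrum (𝓞 K'),
      (Sum.inr w : Place K') ∈ S' ↔ (Sum.inr (w.under (𝓞 K)) : Place K) ∈ S := fun w => by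
    rw [hS'_def, Finset.mem_biUnion]
    constructor
    · rintro ⟨s, hs, hw⟩
      rwa [← (hmem_above_inr s w).mp hw]
    · intro h
      exact ⟨_, h, (hmem_above_inr _ w).mpr rfl⟩
  -- sums over `S'`
  have hdisj : ∀ s ∈ S, ∀ s₂ ∈ S, s ≠ s₂ → Disjoint (above s) (above s₂) := by
    intro s _ s₂ _ hne
    rw [Finset.disjoint_left]
    rintro (w' | w') h1 h2
    · exact hne (((hmem_above_inl s w').mp h1).trans ((hmem_above_inl s₂ w').mp h2).symm)
    · exact hne (((hmem_above_inr s w').mp h1).trans ((hmem_above_inr s₂ w').mp h2).symm)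
  have hsum : ∀ (F : Place K' → ZMod p),
      ∑ s' ∈ S', F s' =
        ∑ s ∈ S, match s with
          | Sum.inl v => ∑ w : {w' : InfinitePlace K' // w'.comap (algebraMap K K') = v}, F (Sum.inl w.1)
          | Sum.inr v => ∑ w : Place K K' v, F (Sum.inr (w : HeightOneSpectrum (𝓞 K'))) := by
    intro F
    rw [hS'_def, Finset.sum_biUnion hdisj]
    refine Finset.sum_congr rfl fun s _ => ?_
    rcases s with v | v
    · rw [habove_inl, Finset.sum_image]
      rintro w - w' - h
      exact Subtype.ext (Sum.inl_injective h)
    · rw [habove_inr, Finset.sum_image]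
      intro w _ w' _ h
      exact SemiLocal.Place.ext (Sum.inr_injective h)
  have hS' : ∀ w : HeightOneSpectrum (𝓞 K'), (Sum.inr w : Place K') ∉ S' →
      ((p : ℕ) : 𝓞 K') ∉ w.asIdeal ∧ GaloisRep.IsUnramifiedAt w ρ' := fun w hw => by
    rw [hS'mem] at hw
    obtain ⟨hpv, hurv⟩ := hS _ hw
    exact ⟨natCast_not_mem_of_under rfl hpv, hram _ ⟨w, rfl⟩ hurv⟩
  -- the family `t'` over `K'`
  let t' : Π w : Place K', galoisCohomology (ρ'.toLocal w) 1 := fun w =>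
    match w with
    | Sum.inl w => ResI (w.comap (algebraMap K K')) ⟨w, rfl⟩ (t (Sum.inl (w.comap (algebraMap K K'))))
    | Sum.inr w => Res (w.under (𝓞 K)) ⟨w, rfl⟩ (t (Sum.inr (w.under (𝓞 K))))
  have ht'inl : ∀ (v : InfinitePlace K) (w : {w' : InfinitePlace K' // w'.comap (algebraMap K K') = v}),
      t' (Sum.inl w.1) = ResI v w (t (Sum.inl v)) := by
    rintro v ⟨w, rfl⟩
    rfl
  have ht'inr : ∀ (v : HeightOneSpectrum (𝓞 K)) (w : Place K K' v),
      t' (Sum.inr (w : HeightOneSpectrum (𝓞 K'))) = Res v w (t (Sum.inr v)) := by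
    rintro v ⟨w, rfl⟩
    rfl
  -- `t'` is orthogonal to `loc H¹_{S'}(K', M'^D)`
  have horth' : ∀ y' : galoisCohomology (ρ'.tateDual p) 1,
      (∀ w : HeightOneSpectrum (𝓞 K'), (Sum.inr w : Place K') ∉ S' →
        galoisCohomology.localization (ρ'.tateDual p) (Sum.inr w) 1 y' ∈
          unramifiedSubgroup (GaloisRep.toLocal w (ρ'.tateDual p)) 1) →
      ∑ w ∈ S', localTatePairingZMod ρ' p w (LocalInvariants.canonical K' p w) (t' w)
        (galoisCohomology.localization (ρ'.tateDual p) w 1 y') = 0 := by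
    intro y' hy'
    -- `Cor^D y'` is unramified outside `S`
    have hY : ∀ v : HeightOneSpectrum (𝓞 K), (Sum.inr v : Place K) ∉ S →
        galoisCohomology.localization (ρ.tateDual p) (Sum.inr v) 1 (CorGD y') ∈
          unramifiedSubgroup (GaloisRep.toLocal v (ρ.tateDual p)) 1 := fun v hv => by
      rw [hsemiD]
      refine AddSubgroup.sum_mem _ fun w _ => hurD v w _ (hy' _ ?_)
      rw [hS'mem, w.under_eq]
      exact hv
    have h0 := horth (CorGD y') hY
    rw [hsum]
    refine (Finset.sum_congr rfl fun s _ => ?_).trans h0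
    rcases s with v | v
    · change ∑ w : {w' : InfinitePlace K' // w'.comap (algebraMap K K') = v}, _ = _
      rw [hsemiDI, map_sum]
      refine Finset.sum_congr rfl fun w _ => ?_
      rw [ht'inl, hadjI]
    · change ∑ w : Place K K' v, _ = _
      rw [hsemiD, map_sum]
      refine Finset.sum_congr rfl fun w _ => ?_
      rw [ht'inr, hadj]
  -- the class over `K'`
  obtain ⟨x', hx'ur, hx'S⟩ := hE' S' hS'inf hS' t' horth'
  -- `u d ≡ 1 (mod p)`
  obtain ⟨u, hu⟩ : ∃ u : ℕ, u * d % p = 1 := by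
    have h1 : Nat.Coprime d p := hd.symm
    haveI : NeZero p := ⟨hp.out.ne_zero⟩
    refine ⟨(ZMod.unitOfCoprime d h1)⁻¹.val.val, ?_⟩
    have h2 : (((ZMod.unitOfCoprime d h1)⁻¹.val.val * d : ℕ) : ZMod p) = 1 := by
      rw [Nat.cast_mul, ZMod.natCast_zmod_val, ← ZMod.coe_unitOfCoprime d h1, Units.inv_mul]
    have h3 := congrArg ZMod.val h2
    rwa [ZMod.val_natCast, ZMod.val_one_eq_one_mod, Nat.mod_eq_of_lt hp.out.one_lt] at h3
  -- `(u * d) • a = a` on `p`-torsion classes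
  have hud : ∀ {F : Type} [Field F] (τ : DiscreteGaloisModule F M) (a : galoisCohomology τ 1),
      (u * d) • a = a := by
    intro F _ τ a
    have hpt : p • a = 0 := galoisCohomology_one_nsmul_eq_zero τ hpM a
    conv_rhs => rw [← one_nsmul a]
    rw [← Nat.div_add_mod (u * d) p, hu, add_nsmul, mul_nsmul, hpt, nsmul_zero, zero_add]
  refine ⟨u • CorG x', fun v hv => ?_, fun v hv => ?_⟩
  · -- unramified outside `S`
    rw [map_nsmul, hsemi]
    refine AddSubgroup.nsmul_mem _ (AddSubgroup.sum_mem _ fun w _ => hur v w _ (hx'ur _ ?_)) u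
    rw [hS'mem, w.under_eq]
    exact hv
  · -- `loc_v x = t_v` on `S`
    rcases v with v | v
    · rw [map_nsmul, hsemiI]
      have hw : ∀ w : {w' : InfinitePlace K' // w'.comap (algebraMap K K') = v},
          galoisCohomology.localization ρ' (Sum.inl w.1) 1 x' = ResI v w (t (Sum.inl v)) := fun w => by
        rw [← ht'inl]
        exact hx'S _ (hS'inf w.1)
      simp only [hw]
      rw [hdegI, ← mul_nsmul']
      exact hud (ρ.toLocal (Sum.inl v)) (t (Sum.inl v))
    · rw [map_nsmul, hsemi]
      have hw : ∀ w : Place K K' v,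
          galoisCohomology.localization ρ' (Sum.inr (w : HeightOneSpectrum (𝓞 K'))) 1 x' =
            Res v w (t (Sum.inr v)) := fun w => by
        rw [← ht'inr]
        refine hx'S _ ?_
        rw [hS'mem, w.under_eq]
        exact hv
      simp only [hw]
      rw [hdeg, ← mul_nsmul']
      exact hud (ρ.toLocal (Sum.inr v)) (t (Sum.inr v))

end Summit.BirchSwinnertonDyer.BirchSwinnertonDyer.Theorems.SignedEC.MuReal

end
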